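import Mathlib
import Summits.Ventures.PercRepro2.TypedPendantA3AtBWeighted
import Summits.Ventures.PercRepro2.TypedPendantA3AtRootWeighted
import Summits.Ventures.PercRepro2.BasePendant
import Summits.Ventures.PercRepro2.PendantBSideBound

/-!
# (HCOV) at a pendant `a₃` at `b`: the weighted reduction rule (blind cell PercRepro2, mine-2 g55,
2026-08-29; `conjectures/MINE-2.md` M2-119)

`TypedPendantA3AtBWeighted.lean` (mine-2 g54) gives, at a pendant `a₃` at `b` with `t = p f`,
`p₀ = p[f := 0]`, `p₁ = p[f := 1]`:
`Gc p = (1 − t²)·Gc p₀ + t²·Gc p₁ − t(1 − t)·X_w`, `X_w` the cubic form under `p₀` of the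
spectator-side-selected root-row covariance kernel.  Here the SIGN of that row is settled:

* **`Gc_update_zero_leaf_b`**: with `a₃` isolated (`p₀`), `Gc p₀` is the `a₃`-inactive value
  `2·P(Q)·[(P(Q,lb)P(Q,ho) − P(Q)P(Q,ho,lb)) + (P(Q,hb)P(Q,lo) − P(Q)P(Q,lo,hb))]` — twice `P(Q)`
  times the two BHK 1.4 cross-cluster slacks;
* **`Xw_eq`**: `X_w = 2·P(Q,hb)·[(P(Q)P(Q,lo,lb) − P(Q,lo)P(Q,lb)) + (P(Q,lo)P(Q,hb) − P(Q)P(Q,lo,hb))]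
  + 2·P(Q,lb)·[(P(Q)P(Q,ho,hb) − P(Q,ho)P(Q,hb)) + (P(Q,ho)P(Q,lb) − P(Q)P(Q,ho,lb))]`;
* **`Xw_le_two_Gc`**: `X_w ≤ 2·Gc p₀` — by the same-side / cross-side bound
  `P(Q,hb)·Cov_Q(lb,lo) ≤ −Cov_Q(hb,lo)` of `PendantBSideBound.lean` and its mirror
  (BHK 1.4 with the avoided set `{a₂, b}` + van den Berg–Kahn), with `P(Q, ·) ≤ P(Q)`;
* **`HCov_pendant_a3_at_b`**: `HCov p₀ → HCov p₁ → HCov p`, since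
  `Gc p = (1 − t)²·Gc p₀ + t²·Gc p₁ + t(1 − t)·(2·Gc p₀ − X_w)`.

So the pendant-`a₃` table of g54 is closed in the weighted form at every mark: at `o`
(`HCov_pendant_a3_at_o`), at the roots (`PendantA3RootHCov.lean`) and at `b` — each (HCOV)
instance with a pendant `a₃` follows from the instances with the leaf removed / merged, with no
typed hypothesis.  Own work; standard axioms.
-/

namespace Summit.Ventures.PercRepro2

open UnionCluster

namespace CovForm

namespace TypedRed

section Isolated

open Classical

variable {V : Type*} {E : Type*} [Fintype E] [DecidableEq E] {R : Type*} [Field R]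
variable (ends : E → Sym2 V) (o a₁ a₂ a₃ b : V)

omit [Fintype E] [DecidableEq E] in
/-- With the leaf edge closed, no other vertex is connected to the leaf. -/
lemma not_conn_to_leaf {f : E} (hf : ends f = s(a₃, b)) (hleaf : ∀ e, a₃ ∈ ends e → e = f)
    (h3b : a₃ ≠ b) {ω : Config E} (hω : ω f = false) {v : V} (hv : v ≠ a₃) :
    ¬ Conn ends ω v a₃ :=
  fun h => hv (conn_leaf_closed hf hleaf h3b hω (conn_symm h))

/-- Under `p[f := 0]`, events that agree on `{f closed}` have the same probability. -/
lemma prob_update_zero_congr_closed' (p : E → R) (f : E) {A B : Set (Config E)}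
    (h : ∀ ω : Config E, ω f = false → (ω ∈ A ↔ ω ∈ B)) :
    prob (Function.update p f 0) A = prob (Function.update p f 0) B := by
  rw [← prob_update_zero_inter_closedEdge p A f, ← prob_update_zero_inter_closedEdge p B f]
  congr 1
  ext ω
  simp only [Set.mem_inter_iff, closedEdge, Set.mem_setOf_eq]
  constructor
  · rintro ⟨hA, hω⟩
    exact ⟨(h ω hω).1 hA, hω⟩
  · rintro ⟨hB, hω⟩
    exact ⟨(h ω hω).2 hB, hω⟩

omit [Fintype E] [DecidableEq E] in
/-- On `{f closed}`, `PD = Q`. -/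
lemma mem_PDEvent_iff_of_closed {f : E} (hf : ends f = s(a₃, b))
    (hleaf : ∀ e, a₃ ∈ ends e → e = f) (h3b : a₃ ≠ b) (h31 : a₃ ≠ a₁) (h32 : a₃ ≠ a₂)
    {ω : Config E} (hω : ω f = false) :
    ω ∈ PDEvent ends a₁ a₂ a₃ ↔ ω ∈ avoidAll ends a₂ {a₁} := by
  simp only [PDEvent, Dtilde, Set.mem_inter_iff, Set.mem_compl_iff, mem_connEvent, mem_inU,
    mem_avoidAll, Finset.mem_singleton, forall_eq]
  constructor
  · rintro ⟨h, _⟩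
    exact fun hc => h (conn_symm hc)
  · intro h
    refine ⟨fun hc => h (conn_symm hc), ?_⟩
    rintro (hc | hc)
    · exact not_conn_to_leaf ends a₃ b hf hleaf h3b hω h31.symm (conn_symm hc)
    · exact not_conn_to_leaf ends a₃ b hf hleaf h3b hω h32.symm (conn_symm hc)

omit [Fintype E] [DecidableEq E] in
/-- On `{f closed}`, `T = {a₁ ∉ C₂, a₃ ∈ C₂}` is empty. -/
lemma not_mem_TEvent_of_closed {f : E} (hf : ends f = s(a₃, b))
    (hleaf : ∀ e, a₃ ∈ ends e → e = f) (h3b : a₃ ≠ b) (h32 : a₃ ≠ a₂) {ω : Config E}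
    (hω : ω f = false) : ω ∉ TEvent ends a₁ a₂ a₃ := by
  simp only [TEvent, Set.mem_inter_iff, Set.mem_compl_iff, mem_connEvent, not_and]
  intro _ hc
  exact not_conn_to_leaf ends a₃ b hf hleaf h3b hω h32.symm hc

variable {ends a₁ a₂ a₃ b} in
/-- The three congruences under `p₀ = p[f := 0]` with `a₃` a leaf at `b`. -/
lemma prob_PD_inter_update_zero {f : E} (hf : ends f = s(a₃, b))
    (hleaf : ∀ e, a₃ ∈ ends e → e = f) (h3b : a₃ ≠ b) (h31 : a₃ ≠ a₁) (h32 : a₃ ≠ a₂)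
    (p : E → R) (X : Set (Config E)) :
    prob (Function.update p f 0) (PDEvent ends a₁ a₂ a₃ ∩ X) =
      prob (Function.update p f 0) (avoidAll ends a₂ {a₁} ∩ X) :=
  prob_update_zero_congr_closed' p f fun ω hω => by
    simp only [Set.mem_inter_iff, mem_PDEvent_iff_of_closed ends a₁ a₂ a₃ b hf hleaf h3b h31 h32 hω]

variable {ends a₁ a₂ a₃ b} in
/-- `P_{p₀}(PD) = P_{p₀}(Q)`. -/
lemma prob_PD_update_zero {f : E} (hf : ends f = s(a₃, b))
    (hleaf : ∀ e, a₃ ∈ ends e → e = f) (h3b : a₃ ≠ b) (h31 : a₃ ≠ a₁) (h32 : a₃ ≠ a₂)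
    (p : E → R) :
    prob (Function.update p f 0) (PDEvent ends a₁ a₂ a₃) =
      prob (Function.update p f 0) (avoidAll ends a₂ {a₁}) :=
  prob_update_zero_congr_closed' p f fun _ hω =>
    mem_PDEvent_iff_of_closed ends a₁ a₂ a₃ b hf hleaf h3b h31 h32 hω

variable {ends a₁ a₂ a₃ b} in
/-- `P_{p₀}(T ∩ X) = 0`. -/
lemma prob_T_inter_update_zero {f : E} (hf : ends f = s(a₃, b))
    (hleaf : ∀ e, a₃ ∈ ends e → e = f) (h3b : a₃ ≠ b) (h32 : a₃ ≠ a₂) (p : E → R)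
    (X : Set (Config E)) :
    prob (Function.update p f 0) (TEvent ends a₁ a₂ a₃ ∩ X) = 0 := by
  have h := prob_update_zero_congr_closed' p f (A := TEvent ends a₁ a₂ a₃ ∩ X) (B := ∅)
    fun ω hω => by
      simp only [Set.mem_inter_iff, Set.mem_empty_iff_false, iff_false, not_and]
      exact fun hT => absurd hT (not_mem_TEvent_of_closed ends a₁ a₂ a₃ b hf hleaf h3b h32 hω)
  rw [h]
  exact prob_empty _

variable {ends a₁ a₂ a₃ b} in
/-- `P_{p₀}(T) = 0`. -/
lemma prob_T_update_zero {f : E} (hf : ends f = s(a₃, b))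
    (hleaf : ∀ e, a₃ ∈ ends e → e = f) (h3b : a₃ ≠ b) (h32 : a₃ ≠ a₂) (p : E → R) :
    prob (Function.update p f 0) (TEvent ends a₁ a₂ a₃) = 0 := by
  have h := prob_update_zero_congr_closed' p f (A := TEvent ends a₁ a₂ a₃) (B := ∅)
    fun ω hω => by
      simp only [Set.mem_empty_iff_false, iff_false]
      exact not_mem_TEvent_of_closed ends a₁ a₂ a₃ b hf hleaf h3b h32 hω
  rw [h]
  exact prob_empty _

end Isolated

section IsolatedGc

open Classical

variable {V : Type*} {E : Type*} [Fintype E] [DecidableEq E] {R : Type*} [Field R]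
  [LinearOrder R] [IsStrictOrderedRing R]
variable (ends : E → Sym2 V) (o a₁ a₂ a₃ b : V)

/-- **`Gc` with the leaf removed is the `a₃`-inactive value**: under `p₀ = p[f := 0]`,
`Gc p₀ = 2·P(Q)·[(P(Q,lb)P(Q,ho) − P(Q)P(Q,ho,lb)) + (P(Q,hb)P(Q,lo) − P(Q)P(Q,lo,hb))]`. -/
theorem Gc_update_zero_leaf_b {f : E} (hf : ends f = s(a₃, b))
    (hleaf : ∀ e, a₃ ∈ ends e → e = f) (h3b : a₃ ≠ b) (h31 : a₃ ≠ a₁) (h32 : a₃ ≠ a₂)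
    (p : E → R) :
    Gc (Function.update p f 0) ends o a₁ a₂ a₃ b =
      2 * prob (Function.update p f 0) (avoidAll ends a₂ {a₁}) *
        ((prob (Function.update p f 0) (avoidAll ends a₂ {a₁} ∩ connEvent ends a₁ b) *
            prob (Function.update p f 0) (avoidAll ends a₂ {a₁} ∩ connEvent ends a₂ o) -
          prob (Function.update p f 0) (avoidAll ends a₂ {a₁}) *
            prob (Function.update p f 0)
              (avoidAll ends a₂ {a₁} ∩ (connEvent ends a₂ o ∩ connEvent ends a₁ b))) +
        (prob (Function.update p f 0) (avoidAll ends a₂ {a₁} ∩ connEvent ends a₂ b) *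
            prob (Function.update p f 0) (avoidAll ends a₂ {a₁} ∩ connEvent ends a₁ o) -
          prob (Function.update p f 0) (avoidAll ends a₂ {a₁}) *
            prob (Function.update p f 0)
              (avoidAll ends a₂ {a₁} ∩ (connEvent ends a₁ o ∩ connEvent ends a₂ b)))) := by
  unfold Gc DEF EQbo EQb3 EQb3o EQo EQ3 EQ3o PDb PDbo Do
  rw [gap_eq_Q]
  simp only [prob_PD_inter_update_zero hf hleaf h3b h31 h32, prob_PD_update_zero hf hleaf h3b h31 h32,
    prob_T_inter_update_zero (a₁ := a₁) (a₂ := a₂) hf hleaf h3b h32,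
    prob_T_inter_update_zero (a₁ := a₂) (a₂ := a₁) hf hleaf h3b h31,
    prob_T_update_zero (a₁ := a₁) (a₂ := a₂) hf hleaf h3b h32,
    prob_T_update_zero (a₁ := a₂) (a₂ := a₁) hf hleaf h3b h31]
  ring

end IsolatedGc

section BRule

open Classical

variable {V : Type*} {E : Type*} [Fintype E] [DecidableEq E] {R : Type*} [Field R]
variable (ends : E → Sym2 V) (o a₁ a₂ a₃ b : V)

/-- The cubic form is linear: a difference of kernels. -/
lemma triSum_empty_sub (p : E → R) (τ : E → ℕ) (K K' : Config E → Config E → Config E → R) :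
    triSum p ∅ τ (fun x y w => K x y w - K' x y w) = triSum p ∅ τ K - triSum p ∅ τ K' := by
  simp only [triSum_empty, mul_sub, Finset.sum_sub_distrib]

/-- The cubic form of a difference of two spectator-times-pair kernels. -/
lemma triSum_X_split (p : E → R) (τ : E → ℕ) (g₁ g₂ : Config E → R)
    (K₁ K₂ : Config E → Config E → R) :
    triSum p ∅ τ (fun x y w => iQ ends a₁ a₂ x * (g₁ x * K₁ y w - g₂ x * K₂ y w)) =
      expect p (fun x => iQ ends a₁ a₂ x * g₁ x) * biForm p p K₁ -
        expect p (fun x => iQ ends a₁ a₂ x * g₂ x) * biForm p p K₂ := by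
  have e : (fun x y w => iQ ends a₁ a₂ x * (g₁ x * K₁ y w - g₂ x * K₂ y w)) =
      fun x y w => (iQ ends a₁ a₂ x * g₁ x) * K₁ y w - (iQ ends a₁ a₂ x * g₂ x) * K₂ y w := by
    funext x y w
    ring
  have h1 : triSum p ∅ τ (fun x y w => (iQ ends a₁ a₂ x * g₁ x) * K₁ y w) =
      expect p (fun x => iQ ends a₁ a₂ x * g₁ x) * biForm p p K₁ :=
    triSum_empty_spec_mul p τ _ _
  have h2 : triSum p ∅ τ (fun x y w => (iQ ends a₁ a₂ x * g₂ x) * K₂ y w) =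
      expect p (fun x => iQ ends a₁ a₂ x * g₂ x) * biForm p p K₂ :=
    triSum_empty_spec_mul p τ _ _
  rw [e, triSum_empty_sub, h1, h2]

/-- **The `X`-term of the `b`-row in one-copy probabilities**. -/
theorem Xw_eq (p : E → R) :
    triSum p ∅ (fun _ => 0) (fun x y w =>
      iQ ends a₁ a₂ x * (iH ends a₂ b x *
        TypedA3.covKer ends a₁ a₂ (iL ends a₁ o) (sigma ends a₁ a₂ b) y w -
        iL ends a₁ b x *
          TypedA3.covKer ends a₁ a₂ (iH ends a₂ o) (sigma ends a₁ a₂ b) y w)) =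
      2 * prob p (avoidAll ends a₂ {a₁} ∩ connEvent ends a₂ b) *
        ((prob p (avoidAll ends a₂ {a₁}) *
            prob p (avoidAll ends a₂ {a₁} ∩ (connEvent ends a₁ o ∩ connEvent ends a₁ b)) -
          prob p (avoidAll ends a₂ {a₁} ∩ connEvent ends a₁ o) *
            prob p (avoidAll ends a₂ {a₁} ∩ connEvent ends a₁ b)) +
        (prob p (avoidAll ends a₂ {a₁} ∩ connEvent ends a₁ o) *
            prob p (avoidAll ends a₂ {a₁} ∩ connEvent ends a₂ b) -
          prob p (avoidAll ends a₂ {a₁}) *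
            prob p (avoidAll ends a₂ {a₁} ∩ (connEvent ends a₁ o ∩ connEvent ends a₂ b)))) +
      2 * prob p (avoidAll ends a₂ {a₁} ∩ connEvent ends a₁ b) *
        ((prob p (avoidAll ends a₂ {a₁}) *
            prob p (avoidAll ends a₂ {a₁} ∩ (connEvent ends a₂ o ∩ connEvent ends a₂ b)) -
          prob p (avoidAll ends a₂ {a₁} ∩ connEvent ends a₂ o) *
            prob p (avoidAll ends a₂ {a₁} ∩ connEvent ends a₂ b)) +
        (prob p (avoidAll ends a₂ {a₁} ∩ connEvent ends a₂ o) *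
            prob p (avoidAll ends a₂ {a₁} ∩ connEvent ends a₁ b) -
          prob p (avoidAll ends a₂ {a₁}) *
            prob p (avoidAll ends a₂ {a₁} ∩ (connEvent ends a₂ o ∩ connEvent ends a₁ b)))) := by
  rw [triSum_X_split, SideBound.biForm_covKer, SideBound.biForm_covKer,
    SideBound.expect_iQ_iL_sigma, SideBound.expect_iQ_iH_sigma, SideBound.expect_iQ_iL,
    SideBound.expect_iQ_iH, SideBound.expect_iQ_sigma, SideBound.expect_iQ_iH,
    SideBound.expect_iQ_iL, expect_f1]
  ring

end BRule

section Sign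

open Classical

variable {V : Type*} {E : Type*} [Fintype E] [DecidableEq E] [Fintype V] [DecidableEq V]
  {R : Type*} [Field R] [LinearOrder R] [IsStrictOrderedRing R]
variable (ends : E → Sym2 V) (o a₁ a₂ a₃ b : V)

/-- **The sign of the `b`-row**: `X_w ≤ 2·Gc p₀`. -/
theorem Xw_le_two_Gc {f : E} (hf : ends f = s(a₃, b))
    (hleaf : ∀ e, a₃ ∈ ends e → e = f) (h3b : a₃ ≠ b) (h31 : a₃ ≠ a₁) (h32 : a₃ ≠ a₂)
    (p : E → R) (hp : IsProbVec p) :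
    triSum (Function.update p f 0) ∅ (fun _ => 0) (fun x y w =>
      iQ ends a₁ a₂ x * (iH ends a₂ b x *
        TypedA3.covKer ends a₁ a₂ (iL ends a₁ o) (sigma ends a₁ a₂ b) y w -
        iL ends a₁ b x *
          TypedA3.covKer ends a₁ a₂ (iH ends a₂ o) (sigma ends a₁ a₂ b) y w)) ≤
      2 * Gc (Function.update p f 0) ends o a₁ a₂ a₃ b := by
  rw [Xw_eq, Gc_update_zero_leaf_b ends o a₁ a₂ a₃ b hf hleaf h3b h31 h32 p]
  have hp0 : IsProbVec (Function.update p f 0) := hp.update f le_rfl zero_le_one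
  have h1 := SideBound.same_side_le_cross (Function.update p f 0) hp0 ends o a₁ a₂ b
  have h2 := SideBound.same_side_le_cross_mirror (Function.update p f 0) hp0 ends o a₁ a₂ b
  have h3 := SideBound.cross_whole (Function.update p f 0) hp0 ends o a₁ a₂ b
  have h4 := SideBound.cross_whole_mirror (Function.update p f 0) hp0 ends o a₁ a₂ b
  have hA := prob_inter_le_left hp0 (avoidAll ends a₂ {a₁}) (connEvent ends a₂ b)
  have hB := prob_inter_le_left hp0 (avoidAll ends a₂ {a₁}) (connEvent ends a₁ b)
  have hA0 := prob_nonneg hp0 (avoidAll ends a₂ {a₁} ∩ connEvent ends a₂ b)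
  have hB0 := prob_nonneg hp0 (avoidAll ends a₂ {a₁} ∩ connEvent ends a₁ b)
  nlinarith [mul_nonneg (sub_nonneg.2 hA) (sub_nonneg.2 h3), mul_nonneg (sub_nonneg.2 hB) (sub_nonneg.2 h4)]

/-- **(HCOV) at a pendant `a₃` at `b`** follows from (HCOV) with the leaf edge pinned closed and
with it pinned open (`b = a₃` merged), for every admissible weight vector. -/
theorem HCov_pendant_a3_at_b {f : E} (hf : ends f = s(a₃, b))
    (hleaf : ∀ e, a₃ ∈ ends e → e = f) (h3b : a₃ ≠ b) (h3o : a₃ ≠ o) (h31 : a₃ ≠ a₁)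
    (h32 : a₃ ≠ a₂) (p : E → R) (hp : IsProbVec p)
    (h0 : HCov (Function.update p f 0) ends o a₁ a₂ a₃ b)
    (h1 : HCov (Function.update p f 1) ends o a₁ a₂ a₃ b) : HCov p ends o a₁ a₂ a₃ b := by
  unfold HCov at h0 h1 ⊢
  rw [Gc_pendant_a3_at_b ends o a₁ a₂ a₃ b hf hleaf h3b h3o h31 h32 p]
  have hX := Xw_le_two_Gc ends o a₁ a₂ a₃ b hf hleaf h3b h31 h32 p hp
  have ht0 := hp.nonneg f
  have ht1 : 0 ≤ 1 - p f := sub_nonneg.2 (hp.le_one f)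
  nlinarith [mul_nonneg (mul_nonneg ht0 ht1) (sub_nonneg.2 hX), mul_nonneg (mul_nonneg ht1 ht1) h0,
    mul_nonneg (mul_nonneg ht0 ht0) h1]

end Sign

end TypedRed

end CovForm

end Summit.Ventures.PercRepro2
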